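import Summits.Parity.GeneralizedHardyLittlewood.Theorems.LeeYangFibresFibreHyperbolicityAlongDefs
import Summits.Parity.GeneralizedHardyLittlewood.Theorems.LeeYangFibresAbsoluteUpgradeAnatomyAlong
import Summits.Parity.GeneralizedHardyLittlewood.Theorems.LeeYangFibresAbsoluteUpgradeQuantClipNumerics
import Summits.Parity.GeneralizedHardyLittlewood.Theorems.LeeYangFibresFibreHyperbolicityAssemble
import Summits.Parity.GeneralizedHardyLittlewood.Theorems.ModelHyperbolicity.Negative.ModelHyperbolicityNotMonotone
import HarnessLib

/-!
# Route `LeeYangFibres`, crux `FibreHyperbolicityAlong` (stmt-Parity-18103), line `sifted-chowla-distillation`: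
# the stub `stub_rankOneAlong` (ghost-free law ⟹ cells near rank one)

We prove the registered stub
`stub_rankOneAlong : GhostFreeLawAlong → CellsNearRankOneAlong`
of the skeleton `Cruxes/FibreHyperbolicityAlong/Lines/sifted_chowla_distillation.lean` (vocabulary:
`Theorems/LeeYangFibresFibreHyperbolicityAlongDefs.lean`).  It is anatomy bookkeeping along the schedule
`U = U(N) = slowDegree N`:

* put `M := β_∞𝔖/(log N)^t` (`β_∞𝔖 = archFactor Ψ K * singularProduct Ψ ≥ ηN > 0`), and
  `a_m := A_m(N) log N/N` (`A_m(N) = cell U N m`), so that the ghost-free model `β_∞𝔖 ∏_i A_{j_i}/N` is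
  `M ∏_i a_{j_i}`;
* for `m < U`, `|a_m - I_m(U)| ≤ (e^{-U²}/8) I_m(U)` (`AnatomyAlong`, PROVED: `DipMarginRateExchange.stub_anatomyAlong`),
  so `|∏ a - ∏ I| ≤ (e^{-U²}/8)(2^t - 1) ∏ I` and `∏ a ≤ 2^t ∏ I` (`rankOne_abs_prod_sub_prod_le`);
* the top cell: `A_U(N) = 0` (`Negative.cell_eq_zero_of_le`) and `I_U(U) = 0` (`ModelTransfer.cellDensity_pred_self`),
  so for `j` touching the top index both products vanish;
* the law's absolute term `N/((log N)^t (log N)^δ)` is at most half the tolerance: `M ≥ ηN/(log N)^t`,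
  `rowTol m U ≥ 1/(U^U)²` (`anatomyAlong_densityLower_nat`), `(log N)^δ ≥ exp(4δU²)` (`quantClip_schedule`) and
  `2 (U^U)^{2t} e^{CU} ≤ η exp(4δU²)` for `U ≥ U₀` (`quantClip_powSelf_le_exp`);
* the relative terms: `2^t e^{-(C+t+2)U} ≤ e^{-CU}/4` and `2^t e^{-U²}/8 ≤ e^{-CU}/4` for `U ≥ ⌈C⌉₊ + t`.

The quantifier-free core is `rankOne_assembly` (abstract cell data); the route's objects enter in
`stub_rankOneAlong` by unification.
-/

noncomputable section

namespace Summit.Parity.GeneralizedHardyLittlewood.Cruxes.FibreHyperbolicityAlong.SiftedChowlaDistillation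

open scoped BigOperators Classical
open Literature.NumberTheory.Sieve
open Summit.Parity.GeneralizedHardyLittlewood.Theses.LeeYangFibres (CellParityLawSaving)
open Summit.Parity.GeneralizedHardyLittlewood.Cruxes.AbsoluteUpgrade.DipMarginRateExchange (slowDegree)
open Summit.Parity.GeneralizedHardyLittlewood.Cruxes.ModelHyperbolicity.WindowChainTransport (cellDensity)
open Summit.Parity.GeneralizedHardyLittlewood.Cruxes.FibreHyperbolicity.ModelTransfer (jointCell fibre)
open Summit.Parity.GeneralizedHardyLittlewood.Cruxes.AbsoluteUpgrade.NlcCellsAbsoluteClip (roughTuples)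
open Summit.Parity.GeneralizedHardyLittlewood.Theorems.ModelHyperbolicity.Negative (cell)
open Summit.Parity.GeneralizedHardyLittlewood.Cruxes.AbsoluteUpgrade.DipMarginRateExchange (four_le_slowDegree
  stub_anatomyAlong anatomyAlong_densityLower_nat quantClip_schedule quantClip_powSelf_le_exp)
open Summit.Parity.GeneralizedHardyLittlewood.Cruxes.ModelHyperbolicity.WindowChainTransport (calc_nonneg)
open Summit.Parity.GeneralizedHardyLittlewood.Cruxes.FibreHyperbolicity.ModelTransfer (cellDensity_pred_self)
open Summit.Parity.GeneralizedHardyLittlewood.Theorems.ModelHyperbolicity.Negative (cell_eq_zero_of_le)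

/-! ## Real-analysis helpers -/

/-- **Relative perturbation of products**: if `|x_i - y_i| ≤ ε y_i` with `y_i ≥ 0` and `0 ≤ ε ≤ 1`, then
`|∏ x - ∏ y| ≤ ε (2^#s - 1) ∏ y`. -/
theorem rankOne_abs_prod_sub_prod_le {ι : Type*} (s : Finset ι) {x y : ι → ℝ} {ε : ℝ} (hε : 0 ≤ ε)
    (hε1 : ε ≤ 1) (hy : ∀ i ∈ s, 0 ≤ y i) (h : ∀ i ∈ s, |x i - y i| ≤ ε * y i) :
    |∏ i ∈ s, x i - ∏ i ∈ s, y i| ≤ ε * (2 ^ s.card - 1) * ∏ i ∈ s, y i := by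
  -- adapted from Literature/Analysis/TotalPositivity/ExpPolySolidMinorsPos.lean (`abs_prod_sub_prod_le`)
  induction s using Finset.induction_on with
  | empty => simp
  | insert a s ha ih =>
    have hy' : ∀ i ∈ s, 0 ≤ y i := fun i hi => hy i (Finset.mem_insert_of_mem hi)
    have h' : ∀ i ∈ s, |x i - y i| ≤ ε * y i := fun i hi => h i (Finset.mem_insert_of_mem hi)
    have ih' := ih hy' h'
    have hya : 0 ≤ y a := hy a (Finset.mem_insert_self a s)
    have hxa : |x a - y a| ≤ ε * y a := h a (Finset.mem_insert_self a s)
    have hY : 0 ≤ ∏ i ∈ s, y i := Finset.prod_nonneg hy'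
    rw [Finset.prod_insert ha, Finset.prod_insert ha, Finset.card_insert_of_notMem ha, pow_succ]
    have hxabs : |x a| ≤ (1 + ε) * y a := by
      have := abs_add_le (y a) (x a - y a)
      rw [add_sub_cancel, abs_of_nonneg hya] at this
      linarith
    have hsplit : x a * ∏ i ∈ s, x i - y a * ∏ i ∈ s, y i =
        x a * (∏ i ∈ s, x i - ∏ i ∈ s, y i) + (x a - y a) * ∏ i ∈ s, y i := by ring
    rw [hsplit]
    have h2 : (0 : ℝ) ≤ 2 ^ s.card - 1 := by
      have : (1 : ℝ) ≤ 2 ^ s.card := one_le_pow₀ (by norm_num)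
      linarith
    have hkey : 0 ≤ ε * y a * (∏ i ∈ s, y i) * (2 ^ s.card - 1) * (1 - ε) := by
      have : 0 ≤ 1 - ε := by linarith
      positivity
    calc |x a * (∏ i ∈ s, x i - ∏ i ∈ s, y i) + (x a - y a) * ∏ i ∈ s, y i|
        ≤ |x a * (∏ i ∈ s, x i - ∏ i ∈ s, y i)| + |(x a - y a) * ∏ i ∈ s, y i| := abs_add_le _ _
      _ = |x a| * |∏ i ∈ s, x i - ∏ i ∈ s, y i| + |x a - y a| * ∏ i ∈ s, y i := by
          rw [abs_mul, abs_mul, abs_of_nonneg hY]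
      _ ≤ (1 + ε) * y a * (ε * (2 ^ s.card - 1) * ∏ i ∈ s, y i) + ε * y a * ∏ i ∈ s, y i :=
          add_le_add (mul_le_mul hxabs ih' (abs_nonneg _) (by positivity))
            (mul_le_mul_of_nonneg_right hxa hY)
      _ ≤ ε * (2 ^ s.card * 2 - 1) * (y a * ∏ i ∈ s, y i) := by nlinarith [hkey]

/-- The two RELATIVE error terms are each a quarter of the tolerance once `U ≥ ⌈C⌉₊ + t`:
`2^t e^{-(C+t+2)U} ≤ e^{-CU}/4` and `2^t e^{-U²}/8 ≤ e^{-CU}/4`. -/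
theorem rankOne_numRel (t U : ℕ) (ht : 1 ≤ t) (C : ℝ) (hU : ⌈C⌉₊ + t ≤ U) :
    2 ^ t * Real.exp (-((C + t + 2) * U)) ≤ Real.exp (-(C * U)) / 4 ∧
      2 ^ t * (Real.exp (-((U : ℝ) ^ 2)) / 8) ≤ Real.exp (-(C * U)) / 4 := by
  have hU1 : (1 : ℝ) ≤ U := by exact_mod_cast (le_trans ht (le_trans (Nat.le_add_left _ _) hU))
  have hUC : (t : ℝ) ≤ U - C := by
    have h1 : (⌈C⌉₊ : ℝ) + t ≤ U := by exact_mod_cast hU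
    have h2 : C ≤ ⌈C⌉₊ := Nat.le_ceil C
    linarith
  have ht1 : (1 : ℝ) ≤ t := by exact_mod_cast ht
  have h2e : (2 : ℝ) ≤ Real.exp 1 := by
    have := Real.add_one_le_exp (1 : ℝ)
    norm_num at this
    exact this
  -- `2^n ≤ exp n`
  have hpow : ∀ n : ℕ, (2 : ℝ) ^ n ≤ Real.exp n := fun n => by
    have := pow_le_pow_left₀ (by norm_num : (0 : ℝ) ≤ 2) h2e n
    rwa [← Real.exp_nat_mul, mul_one] at this
  constructor
  · have hsplit : Real.exp (-((C + t + 2) * U)) = Real.exp (-(C * U)) * Real.exp (-((t + 2) * U)) := by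
      rw [← Real.exp_add]; congr 1; ring
    have hkey : (2 : ℝ) ^ (t + 2) * Real.exp (-((t + 2) * U)) ≤ 1 := by
      rw [Real.exp_neg, ← div_eq_mul_inv, div_le_one (Real.exp_pos _)]
      refine (hpow (t + 2)).trans ?_
      rw [Real.exp_le_exp]
      push_cast
      nlinarith
    rw [hsplit, le_div_iff₀ (by norm_num : (0 : ℝ) < 4)]
    calc 2 ^ t * (Real.exp (-(C * U)) * Real.exp (-((t + 2) * U))) * 4
        = Real.exp (-(C * U)) * (2 ^ (t + 2) * Real.exp (-((t + 2) * U))) := by ring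
      _ ≤ Real.exp (-(C * U)) * 1 := mul_le_mul_of_nonneg_left hkey (Real.exp_pos _).le
      _ = Real.exp (-(C * U)) := mul_one _
  · have hkey : (2 : ℝ) ^ t * Real.exp (-((U : ℝ) ^ 2)) ≤ Real.exp (-(C * U)) := by
      have h1 : (2 : ℝ) ^ t ≤ Real.exp ((U : ℝ) ^ 2 - C * U) := by
        refine (hpow t).trans ?_
        rw [Real.exp_le_exp]
        nlinarith [mul_nonneg (sub_nonneg.mpr hU1) (le_trans (by positivity) hUC)]
      calc (2 : ℝ) ^ t * Real.exp (-((U : ℝ) ^ 2))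
          ≤ Real.exp ((U : ℝ) ^ 2 - C * U) * Real.exp (-((U : ℝ) ^ 2)) :=
            mul_le_mul_of_nonneg_right h1 (Real.exp_pos _).le
        _ = Real.exp (-(C * U)) := by rw [← Real.exp_add]; congr 1; ring
    have hE := Real.exp_pos (-(C * U))
    nlinarith

/-- The law's saving beats the density floor: for `U ≥ U₀(δ, η, t, C)`,
`2 ((U^U)²)^t ≤ e^{-CU} · η · exp(4U²δ)`. -/
theorem rankOne_numAbs {δ η : ℝ} (hδ : 0 < δ) (hη : 0 < η) {t : ℕ} (ht : 1 ≤ t) (C : ℝ) :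
    ∃ U₀ : ℕ, ∀ U : ℕ, U₀ ≤ U →
      2 * (((U : ℝ) ^ U) ^ 2) ^ t ≤ Real.exp (-(C * U)) * η * Real.exp (4 * (U : ℝ) ^ 2 * δ) := by
  have ht0 : (0 : ℝ) < t := by exact_mod_cast ht
  obtain ⟨U₂, hU₂⟩ := quantClip_powSelf_le_exp (div_pos hδ ht0) 0 1
  obtain ⟨U₃, hU₃⟩ := quantClip_powSelf_le_exp hδ 0 (2 / η)
  refine ⟨U₂ + U₃ + ⌈C / δ⌉₊ + 1, fun U hU => ?_⟩
  have hU1 : (1 : ℝ) ≤ U := by exact_mod_cast (by omega : 1 ≤ U)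
  -- (i) `(U^U)^{2t} ≤ exp(2δU²)`
  have h2 := hU₂ U (by omega)
  rw [one_mul, add_zero] at h2
  have hi : (((U : ℝ) ^ U) ^ 2) ^ t ≤ Real.exp (2 * δ * (U : ℝ) ^ 2) := by
    calc (((U : ℝ) ^ U) ^ 2) ^ t = ((U : ℝ) ^ U) ^ (2 * t) := by rw [pow_mul]
      _ ≤ (Real.exp (δ / t * (U : ℝ) ^ 2)) ^ (2 * t) := pow_le_pow_left₀ (by positivity) h2 _
      _ = Real.exp (2 * δ * (U : ℝ) ^ 2) := by
          rw [← Real.exp_nat_mul]; congr 1; push_cast; field_simp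
  -- (ii) `exp(CU) ≤ exp(δU²)`
  have hii : Real.exp (C * U) ≤ Real.exp (δ * (U : ℝ) ^ 2) := by
    rw [Real.exp_le_exp]
    have hc : C / δ ≤ U := le_trans (Nat.le_ceil _) (by exact_mod_cast (by omega : ⌈C / δ⌉₊ ≤ U))
    rw [div_le_iff₀ hδ] at hc
    nlinarith
  -- (iii) `2/η ≤ exp(δU²)`
  have hiii : 2 / η ≤ Real.exp (δ * (U : ℝ) ^ 2) := by
    refine le_trans ?_ (hU₃ U (by omega))
    rw [add_zero]
    exact le_mul_of_one_le_right (by positivity) (one_le_pow₀ hU1)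
  have hE : Real.exp (-(C * U)) * Real.exp (C * U) = 1 := by
    rw [← Real.exp_add, neg_add_cancel, Real.exp_zero]
  calc 2 * (((U : ℝ) ^ U) ^ 2) ^ t
      = (Real.exp (-(C * U)) * Real.exp (C * U)) * (η * (2 / η)) * (((U : ℝ) ^ U) ^ 2) ^ t := by
        rw [hE, mul_div_cancel₀ _ hη.ne']; ring
    _ ≤ (Real.exp (-(C * U)) * Real.exp (δ * (U : ℝ) ^ 2)) * (η * Real.exp (δ * (U : ℝ) ^ 2)) *
          Real.exp (2 * δ * (U : ℝ) ^ 2) := by gcongr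
    _ = Real.exp (-(C * U)) * η * Real.exp (4 * (U : ℝ) ^ 2 * δ) := by
        have : Real.exp (δ * (U : ℝ) ^ 2) * Real.exp (δ * (U : ℝ) ^ 2) * Real.exp (2 * δ * (U : ℝ) ^ 2) =
            Real.exp (4 * (U : ℝ) ^ 2 * δ) := by
          rw [← Real.exp_add, ← Real.exp_add]; congr 1; ring
        rw [← this]; ring

/-- The law's ABSOLUTE term is at most half the tolerance floor (abstract form): with `D ≤ X` (`D = exp(4δU²)`,
`X = (log N)^δ`), `ηN ≤ MS`, `V = (U^U)²` and `2 V^t ≤ E η D`: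
`N/((log N)^t X) ≤ E (MS/(log N)^t) (1/V)^t / 2`. -/
theorem rankOne_absTerm {t : ℕ} {N Lg D X MS η E V : ℝ} (hN : 0 ≤ N) (hLg : 0 < Lg) (hD : 0 < D)
    (hDX : D ≤ X) (hη : 0 < η) (hmass : η * N ≤ MS) (hE : 0 < E) (hV : 0 < V)
    (hnum : 2 * V ^ t ≤ E * η * D) :
    N / (Lg ^ t * X) ≤ E * (MS / Lg ^ t) * (1 / V) ^ t / 2 := by
  have hLt : 0 < Lg ^ t := pow_pos hLg t
  have hinv : 1 / D ≤ E * η * (1 / V) ^ t / 2 := by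
    rw [one_div_le hD (by positivity)]
    calc 1 / (E * η * (1 / V) ^ t / 2) = 2 * V ^ t / (E * η) := by
          rw [one_div_pow]; field_simp
      _ ≤ D := by rw [div_le_iff₀ (by positivity)]; linarith
  calc N / (Lg ^ t * X) ≤ N / (Lg ^ t * D) :=
        div_le_div_of_nonneg_left hN (mul_pos hLt hD) (mul_le_mul_of_nonneg_left hDX hLt.le)
    _ = (N / Lg ^ t) * (1 / D) := by field_simp
    _ ≤ (N / Lg ^ t) * (E * η * (1 / V) ^ t / 2) := mul_le_mul_of_nonneg_left hinv (by positivity)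
    _ = E * (η * N / Lg ^ t) * (1 / V) ^ t / 2 := by ring
    _ ≤ E * (MS / Lg ^ t) * (1 / V) ^ t / 2 := by gcongr

/-- The density floor of the tolerance: `1/(U^U)² ≤ rowTol m U` for `1 ≤ m ≤ U`, `U ≥ 2`
(`anatomyAlong_densityLower_nat` at `j = m - 1` off the top index, and at `j = U - 2` — the extra summand of
`rowTol U U` — at the top index, where `I_U(U) = 0`). -/
theorem rankOne_rowTol_floor {m U : ℕ} (hU : 2 ≤ U) (hm1 : 1 ≤ m) (hmU : m ≤ U) :
    1 / ((U : ℝ) ^ U) ^ 2 ≤ rowTol m U := by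
  rcases lt_or_eq_of_le hmU with hlt | rfl
  · rw [rowTol_of_ne hlt.ne]
    exact anatomyAlong_densityLower_nat (by omega)
  · rw [rowTol_self]
    exact le_add_of_nonneg_of_le (calc_nonneg _ _) (anatomyAlong_densityLower_nat (by omega))

/-- `I_m(U) ≤ rowTol m U`. -/
theorem rankOne_cellDensity_le_rowTol (m U : ℕ) : cellDensity (m - 1) U ≤ rowTol m U := by
  unfold rowTol
  split_ifs
  · exact le_add_of_nonneg_right (calc_nonneg _ _)
  · simp

/-! ## The assembly (abstract cell data) -/

/-- **Assembly.**  Abstract form of the stub at one `N`: `a m` are the normalised single-form cells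
`A_m(N) log N/N` (`a U = 0`, anatomy `|a m - I_m| ≤ ε I_m` for `m < U`), `Cj` a joint cell, `M > 0` the scale,
the ghost-free law `|Cj - M ∏ a| ≤ E' M ∏ a + R` with `2^t E' ≤ E/4`, `2^t ε ≤ E/4`, `ε ≤ 1`, and the absolute
term `R ≤ E M (1/(U^U)²)^t/2`; then `|Cj - M ∏ I| ≤ E M ∏ rowTol`. -/
theorem rankOne_assembly {t U : ℕ} (hU : 2 ≤ U) {a : ℕ → ℝ} {Cj M E E' R ε : ℝ} (hM : 0 < M)
    (hE : 0 ≤ E) (hE'0 : 0 ≤ E') (hE' : 2 ^ t * E' ≤ E / 4) (hε0 : 0 ≤ ε) (hε1 : ε ≤ 1)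
    (hε : 2 ^ t * ε ≤ E / 4) (hatop : a U = 0)
    (hanat : ∀ m : ℕ, 1 ≤ m → m < U → |a m - cellDensity (m - 1) U| ≤ ε * cellDensity (m - 1) U)
    (hR : R ≤ E * M * (1 / ((U : ℝ) ^ U) ^ 2) ^ t / 2)
    (j : Fin t → ℕ) (hj : ∀ i, 1 ≤ j i ∧ j i ≤ U)
    (hlaw : |Cj - M * ∏ i, a (j i)| ≤ E' * (M * ∏ i, a (j i)) + R) :
    |Cj - M * ∏ i, cellDensity (j i - 1) U| ≤ E * M * ∏ i, rowTol (j i) U := by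
  -- the tolerance product dominates the density product and the floor
  have hPI0 : 0 ≤ ∏ i, cellDensity (j i - 1) (U : ℝ) := Finset.prod_nonneg fun i _ => calc_nonneg _ _
  have hPIrow : ∏ i, cellDensity (j i - 1) (U : ℝ) ≤ ∏ i, rowTol (j i) U :=
    Finset.prod_le_prod (fun i _ => calc_nonneg _ _) fun i _ => rankOne_cellDensity_le_rowTol _ _
  have hρP : (1 / ((U : ℝ) ^ U) ^ 2) ^ t ≤ ∏ i, rowTol (j i) U := by
    calc (1 / ((U : ℝ) ^ U) ^ 2) ^ t = ∏ _i : Fin t, 1 / ((U : ℝ) ^ U) ^ 2 := by simp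
      _ ≤ ∏ i, rowTol (j i) U :=
          Finset.prod_le_prod (fun _ _ => by positivity) fun i _ => rankOne_rowTol_floor hU (hj i).1 (hj i).2
  have hR' : R ≤ E * M * (∏ i, rowTol (j i) U) / 2 :=
    hR.trans (div_le_div_of_nonneg_right (mul_le_mul_of_nonneg_left hρP (mul_nonneg hE hM.le)) (by norm_num))
  have hEMP : 0 ≤ E * M * ∏ i, rowTol (j i) U := mul_nonneg (mul_nonneg hE hM.le) (hPI0.trans hPIrow)
  by_cases htop : ∃ i, j i = U
  · -- a top index: both products vanish
    obtain ⟨i₀, hi₀⟩ := htop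
    have hpa : ∏ i, a (j i) = 0 := Finset.prod_eq_zero (Finset.mem_univ i₀) (by rw [hi₀]; exact hatop)
    have hpI : ∏ i, cellDensity (j i - 1) (U : ℝ) = 0 :=
      Finset.prod_eq_zero (Finset.mem_univ i₀) (by rw [hi₀]; exact cellDensity_pred_self hU)
    rw [hpa] at hlaw
    rw [hpI]
    simp only [mul_zero, sub_zero, zero_add] at hlaw ⊢
    linarith
  · push Not at htop
    have hjlt : ∀ i, j i < U := fun i => lt_of_le_of_ne (hj i).2 (htop i)
    have hpert : |∏ i, a (j i) - ∏ i, cellDensity (j i - 1) (U : ℝ)| ≤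
        ε * (2 ^ t - 1) * ∏ i, cellDensity (j i - 1) (U : ℝ) := by
      have := rankOne_abs_prod_sub_prod_le (Finset.univ : Finset (Fin t)) hε0 hε1
        (fun i _ => calc_nonneg _ _) (fun i _ => hanat (j i) (hj i).1 (hjlt i))
      rwa [Finset.card_univ, Fintype.card_fin] at this
    have h2t : (1 : ℝ) ≤ 2 ^ t := one_le_pow₀ (by norm_num)
    have hPa : ∏ i, a (j i) ≤ 2 ^ t * ∏ i, cellDensity (j i - 1) (U : ℝ) := by
      have h1 := (abs_sub_le_iff.mp hpert).1
      nlinarith [mul_nonneg (mul_nonneg hε0 (sub_nonneg.mpr h2t)) hPI0, mul_nonneg (sub_nonneg.mpr hε1) hPI0,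
        mul_nonneg (mul_nonneg (sub_nonneg.mpr hε1) (sub_nonneg.mpr h2t)) hPI0]
    calc |Cj - M * ∏ i, cellDensity (j i - 1) (U : ℝ)|
        = |(Cj - M * ∏ i, a (j i)) + M * (∏ i, a (j i) - ∏ i, cellDensity (j i - 1) (U : ℝ))| := by
          congr 1; ring
      _ ≤ |Cj - M * ∏ i, a (j i)| + |M * (∏ i, a (j i) - ∏ i, cellDensity (j i - 1) (U : ℝ))| :=
          abs_add_le _ _
      _ = |Cj - M * ∏ i, a (j i)| + M * |∏ i, a (j i) - ∏ i, cellDensity (j i - 1) (U : ℝ)| := by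
          rw [abs_mul, abs_of_pos hM]
      _ ≤ (E' * (M * ∏ i, a (j i)) + R) + M * (ε * (2 ^ t - 1) * ∏ i, cellDensity (j i - 1) (U : ℝ)) :=
          add_le_add hlaw (mul_le_mul_of_nonneg_left hpert hM.le)
      _ ≤ (E' * (M * (2 ^ t * ∏ i, cellDensity (j i - 1) (U : ℝ))) + R) +
            M * (ε * 2 ^ t * ∏ i, cellDensity (j i - 1) (U : ℝ)) := by
          refine add_le_add (add_le_add ?_ le_rfl) ?_
          · exact mul_le_mul_of_nonneg_left (mul_le_mul_of_nonneg_left hPa hM.le) hE'0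
          · refine mul_le_mul_of_nonneg_left (mul_le_mul_of_nonneg_right ?_ hPI0) hM.le
            nlinarith
      _ = (2 ^ t * E') * M * (∏ i, cellDensity (j i - 1) (U : ℝ)) +
            (2 ^ t * ε) * M * (∏ i, cellDensity (j i - 1) (U : ℝ)) + R := by ring
      _ ≤ (E / 4) * M * (∏ i, rowTol (j i) U) + (E / 4) * M * (∏ i, rowTol (j i) U) +
            E * M * (∏ i, rowTol (j i) U) / 2 := by
          refine add_le_add (add_le_add ?_ ?_) hR'
          · exact mul_le_mul (mul_le_mul_of_nonneg_right hE' hM.le) hPIrow hPI0 (by positivity)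
          · exact mul_le_mul (mul_le_mul_of_nonneg_right hε hM.le) hPIrow hPI0 (by positivity)
      _ = E * M * ∏ i, rowTol (j i) U := by ring

/-! ## The registered stub -/

/-- **Stub `stub_rankOneAlong` (registered; anatomy bookkeeping — lead reshape v2, second half of
`stub_walshAlong`).**  Ghost-free law ⟹ cells near rank one: put `M := β_∞𝔖/(log N)^t`; for `m < U`,
`A_m(N) log N/N = I_m(U)(1 ± e^{-U²}/8)` (`AnatomyAlong`, PROVED: `DipMarginRateExchange.stub_anatomyAlong`), and
`A_U(N) = 0 = I_U(U)`; so `|C_j - M ∏ I_{j_i}| ≤ (2^t e^{-(C+t+2)U} + 2^t e^{-U²}/8) M ∏ I_{j_i} + N(log N)^{-t-δ}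
≤ ½ e^{-CU} M ∏ rowTol(j_i) + N (log N)^{-t-δ}`, and the last term is `≤ ½ e^{-CU} M ∏_i rowTol(j_i)` because
`M ≥ ηN/(log N)^t`, `rowTol m U ≥ 1/(U^U)²` (`anatomyAlong_densityLower_nat`) and `(log N)^{-δ} ≤ e^{-4δU²}`
(`quantClip_schedule`), with `2 (U^U)^{2t} e^{CU} ≤ η e^{4δU²}` for large `U` (`quantClip_powSelf_le_exp`). -/
theorem stub_rankOneAlong : GhostFreeLawAlong → CellsNearRankOneAlong := by
  intro hG t L ht η hη C
  obtain ⟨δ, hδ, N₁, hN₁⟩ := hG t L ht η hη (C + t + 2)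
  have hA : ∃ N₀ : ℕ, ∀ N : ℕ, N₀ ≤ N → ∀ m : ℕ, 1 ≤ m → m < slowDegree N →
      |(cell (slowDegree N) N m : ℝ) * Real.log N / N - cellDensity (m - 1) (slowDegree N)| ≤
        Real.exp (-((slowDegree N : ℝ) ^ 2)) / 8 * cellDensity (m - 1) (slowDegree N) :=
    stub_anatomyAlong
  obtain ⟨N₂, hN₂⟩ := hA
  obtain ⟨U₀, hU₀⟩ := rankOne_numAbs hδ hη ht C
  obtain ⟨N₃, hN₃⟩ := quantClip_schedule (U₀ + ⌈C⌉₊ + t)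
  refine ⟨N₁ + N₂ + N₃, fun N hN Ψ hΨ hL K hK hKN hmass => ?_⟩
  obtain ⟨hU₀U, hN16, hsched, -⟩ := hN₃ N (by omega)
  have hlawN := hN₁ N (by omega) Ψ hΨ hL K hK hKN hmass
  have hanatN := hN₂ N (by omega)
  set U : ℕ := slowDegree N with hUdef
  have hU4 : 4 ≤ U := four_le_slowDegree N
  have hNpos : (0 : ℝ) < N := by exact_mod_cast (by omega : 0 < N)
  have hLg : 0 < Real.log N := Real.log_pos (by exact_mod_cast (by omega : 1 < N))
  have hMS : 0 < archFactor Ψ K * singularProduct Ψ := lt_of_lt_of_le (mul_pos hη hNpos) hmass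
  set MS : ℝ := archFactor Ψ K * singularProduct Ψ with hMSdef
  set Lg : ℝ := Real.log N with hLgdef
  refine ⟨MS / Lg ^ t, div_pos hMS (pow_pos hLg t), fun j hj => ?_⟩
  have hj' : ∀ i, 1 ≤ j i ∧ j i ≤ U := fun i => Finset.mem_Icc.mp (Fintype.mem_piFinset.mp hj i)
  have hlaw := hlawN j hj
  -- the ghost-free model is `M ∏ a`
  have hprod : ∏ i, ((cell U N (j i) : ℝ) * Lg / N) = (∏ i, (cell U N (j i) : ℝ) / N) * Lg ^ t := by
    have h1 : ∀ i : Fin t, (cell U N (j i) : ℝ) * Lg / N = (cell U N (j i) : ℝ) / N * Lg := fun i => by ring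
    simp_rw [h1, Finset.prod_mul_distrib, Finset.prod_const, Finset.card_univ, Fintype.card_fin]
  have key : MS * ∏ i, (cell U N (j i) : ℝ) / N = MS / Lg ^ t * ∏ i, ((cell U N (j i) : ℝ) * Lg / N) := by
    rw [hprod]; field_simp
  rw [key] at hlaw
  -- the thresholds
  obtain ⟨hrel1, hrel2⟩ := rankOne_numRel t U ht C (by omega)
  have hnum := hU₀ U (by omega)
  have hD : Real.exp (4 * (U : ℝ) ^ 2 * δ) ≤ Lg ^ δ := by
    rw [Real.exp_mul]
    exact Real.rpow_le_rpow (Real.exp_pos _).le hsched hδ.le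
  have hU0 : (0 : ℝ) < U := by exact_mod_cast (by omega : 0 < U)
  have hR := rankOne_absTerm (t := t) hNpos.le hLg (Real.exp_pos _) hD hη hmass (Real.exp_pos (-(C * U)))
    (by positivity : (0 : ℝ) < ((U : ℝ) ^ U) ^ 2) hnum
  have htop : (cell U N U : ℝ) * Lg / N = 0 := by
    rw [cell_eq_zero_of_le (by omega) le_rfl]; simp
  have hε1 : Real.exp (-((U : ℝ) ^ 2)) / 8 ≤ 1 := by
    have h1 : Real.exp (-((U : ℝ) ^ 2)) ≤ 1 := by rw [Real.exp_le_one_iff]; nlinarith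
    linarith
  -- the top cell, the anatomy and the law enter the assembly by unification (`a m := A_m(N) log N/N`)
  exact rankOne_assembly (a := fun m => (cell U N m : ℝ) * Lg / N) (by omega) (div_pos hMS (pow_pos hLg t))
    (Real.exp_pos _).le (Real.exp_pos _).le hrel1 (by positivity) hε1 hrel2 htop
    (fun m hm hmU => hanatN m hm hmU) hR j hj' hlaw

end Summit.Parity.GeneralizedHardyLittlewood.Cruxes.FibreHyperbolicityAlong.SiftedChowlaDistillation

end
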